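import Summits.HubbardSuperconductivity.HubbardSuperconductivity.Theorems.AnisotropyChordTransferFibre3Freeze
import Summits.HubbardSuperconductivity.HubbardSuperconductivity.Theorems.AnisotropyChordTransferFibre3PoleCount
import Summits.HubbardSuperconductivity.HubbardSuperconductivity.Theorems.AnisotropyChordTransferFibre3KTAssemblyClosedRho

/-!
# Route `AnisotropyChord` / H0 rotor rung: PartN36 — LEMMA V′ PROVED (`LemmaVPrimeSharp`, `LemmaVPrime`, `SecondGapK1OfHole75`)

Theory seat `hubbard-h0-rotor-theory-1` g21, memo ROTOR-THEORY-21 §313(c), typed targets of `…Fibre3LemmaVTargets`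
(PORT PartN36).  With `freezeIdentity_holds` (`…Fibre3Freeze`) and `poleCount_holds` (`…Fibre3PoleCount`):
* `frozen_row_bound`: the two-hole Poincaré inequality `TwoHoleGap L g` applied to `f − mean` on one frozen line
  (`sum_ite_two`, `punctured_variance`: `Σ_{x∉ζ}|f x − m|² = Σ|f|² − |Σf|²/(V−2)` for `f` vanishing on the two holes);
* `fam2_bound`, `fam3_bound`, `fam1_bound`: the three families of frozen Dirichlet forms, summed over the lines
  (family 1 along the diagonal `c = (b+d, b)` after removing the `K₁`-twist by the unit gauge `conj φ_{K₁}(b)`);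
* **`lemmaVPrimeSharp_holds (hL : 3 ≤ L)`**, **`lemmaVPrime_holds (hL : 3 ≤ L)`**,
  **`secondGapK1OfHole75_holds : SecondGapK1OfHole75 L`** (every `L`; the statement carries `4 ≤ L`);
* assembly corollaries `gm3_of_cruxes_twoHoleGap`, `gm3_closedRho_twoHoleGap`: in `gm3_of_cruxes_secondGap` /
  `gm3_closedRho_secondGap` the spectral hypothesis `SecondGapK1 L (ε₁cos²θ/2)` is replaced by the ONE-BODY
  random-walk statement HOLE₂(.75) = `TwoHoleGap L (3/4·ε₁)`.
Prover seat `hubbard-h0-rotor-p1` g23; helper for stmt-HubbardSuperconductivity-19089 (`--supports`).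
-/

set_option linter.dupNamespace false
set_option autoImplicit false

noncomputable section

open scoped BigOperators
open Complex

namespace Summit.HubbardSuperconductivity.HubbardSuperconductivity.Theorems.AnisotropyChord.Transfer.Fibre3

variable (L : ℕ) [NeZero L]

/-! ## Sums over a twice-punctured torus -/

/-- removing two distinct points from a sum. [folklore] -/
theorem sum_ite_two {α : Type*} [AddCommGroup α] (h : Tor L → α) {z₁ z₂ : Tor L} (hz : z₁ ≠ z₂) :
    ∑ x : Tor L, (if (x = z₁ ∨ x = z₂) then (0 : α) else h x) = ∑ x : Tor L, h x - h z₁ - h z₂ := by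
  classical
  have key : ∀ x : Tor L, (if (x = z₁ ∨ x = z₂) then (0 : α) else h x)
      = h x - (if x = z₁ then h x else 0) - (if x = z₂ then h x else 0) := by
    intro x
    by_cases h1 : x = z₁
    · simp [h1, hz]
    · by_cases h2 : x = z₂
      · simp [h2, hz.symm]
      · simp [h1, h2]
  rw [Finset.sum_congr rfl (fun x _ => key x), Finset.sum_sub_distrib, Finset.sum_sub_distrib,
    Finset.sum_ite_eq', Finset.sum_ite_eq']
  simp

omit [NeZero L] in
/-- `L² ≠ 2`. [folklore] -/
theorem Lsq_sub_two_ne_zero : ((L : ℝ) ^ 2 - 2) ≠ 0 := by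
  rcases Nat.lt_or_ge L 2 with h | h
  · have : (L : ℝ) ≤ 1 := by exact_mod_cast (by omega : L ≤ 1)
    have h0 : (0 : ℝ) ≤ L := Nat.cast_nonneg L
    nlinarith
  · have : (2 : ℝ) ≤ L := by exact_mod_cast h
    nlinarith

/-- `|Tor L| = L²` as a real number. [folklore] -/
theorem card_Tor_real : (Fintype.card (Tor L) : ℝ) = (L : ℝ) ^ 2 := by
  rw [Fintype.card_prod, ZMod.card]; push_cast; ring

/-- **punctured variance:** for `f` vanishing at two distinct points and `m = (Σ f)/(V − 2)`,
`Σ_{x ∉ ζ} |f x − m|² = Σ |f x|² − |Σ f|²/(V − 2)`. [folklore] -/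
theorem punctured_variance (f : Tor L → ℂ) {z₁ z₂ : Tor L} (hz : z₁ ≠ z₂) (hf1 : f z₁ = 0) (hf2 : f z₂ = 0) :
    ∑ x : Tor L, (if (x = z₁ ∨ x = z₂) then (0 : ℝ)
        else ‖f x - (∑ y : Tor L, f y) / ((((L : ℝ) ^ 2 - 2 : ℝ)) : ℂ)‖ ^ 2)
      = ∑ x : Tor L, ‖f x‖ ^ 2 - ‖∑ y : Tor L, f y‖ ^ 2 / ((L : ℝ) ^ 2 - 2) := by
  have hc : ((L : ℝ) ^ 2 - 2) ≠ 0 := Lsq_sub_two_ne_zero L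
  set c : ℝ := (L : ℝ) ^ 2 - 2 with hcdef
  set S : ℂ := ∑ y : Tor L, f y with hSdef
  set m : ℂ := S / (c : ℂ) with hmdef
  rw [sum_ite_two L _ hz, hf1, hf2, zero_sub, norm_neg]
  have hnm : ‖m‖ ^ 2 = ‖S‖ ^ 2 / c ^ 2 := by
    rw [hmdef, norm_div, Complex.norm_real, Real.norm_eq_abs, div_pow, sq_abs]
  have hre : (∑ x : Tor L, (starRingEnd ℂ) (f x) * m).re = ‖S‖ ^ 2 / c := by
    rw [← Finset.sum_mul, ← map_sum, ← hSdef, hmdef, mul_div_assoc', Complex.conj_mul', ← Complex.ofReal_pow,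
      ← Complex.ofReal_div, Complex.ofReal_re]
  have hsum : ∑ x : Tor L, ‖f x - m‖ ^ 2 = ∑ x : Tor L, ‖f x‖ ^ 2 + (L : ℝ) ^ 2 * ‖m‖ ^ 2 - 2 * (‖S‖ ^ 2 / c) := by
    simp_rw [norm_sub_sq_conj]
    rw [Finset.sum_sub_distrib, Finset.sum_add_distrib, Finset.sum_const, Finset.card_univ, nsmul_eq_mul,
      card_Tor_real, ← Finset.mul_sum, ← Complex.re_sum, hre]
  rw [hsum, hnm]
  field_simp
  ring

/-! ## One frozen line: the two-hole Poincaré inequality applied to `f − mean` -/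

/-- **row bound:** `TwoHoleGap L g`, a line function `f` vanishing on the two holes, and the guarded squared differences
`F x e = [x, x+e ∉ ζ]·|f x − f(x+e)|²` give `g(Σ|f|² − |Σf|²/(V−2)) ≤ ¼ Σ_x Σ_{e=±eₓ,±e_y} F x e`. [folklore] -/
theorem frozen_row_bound {g : ℝ} (hG : TwoHoleGap L g) {z₁ z₂ : Tor L} (hz : z₁ ≠ z₂) (f : Tor L → ℂ)
    (hf1 : f z₁ = 0) (hf2 : f z₂ = 0) (F : Tor L → Tor L → ℝ)
    (hF : ∀ x e, F x e = if (x = z₁ ∨ x = z₂ ∨ x + e = z₁ ∨ x + e = z₂) then 0 else ‖f x - f (x + e)‖ ^ 2) :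
    g * (∑ x : Tor L, ‖f x‖ ^ 2 - ‖∑ x : Tor L, f x‖ ^ 2 / ((L : ℝ) ^ 2 - 2))
      ≤ (1 / 4) * ∑ x : Tor L, (F x (ex L) + F x (-ex L) + F x (ey L) + F x (-ey L)) := by
  have hc : ((L : ℝ) ^ 2 - 2) ≠ 0 := Lsq_sub_two_ne_zero L
  have hcC : ((((L : ℝ) ^ 2 - 2 : ℝ)) : ℂ) ≠ 0 := Complex.ofReal_ne_zero.mpr hc
  set m : ℂ := (∑ y : Tor L, f y) / ((((L : ℝ) ^ 2 - 2 : ℝ)) : ℂ) with hmdef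
  have hzero : (∑ x : Tor L, (if (x = z₁ ∨ x = z₂) then (0 : ℂ) else (fun x => f x - m) x)) = 0 := by
    beta_reduce
    rw [sum_ite_two L _ hz, hf1, hf2, Finset.sum_sub_distrib, Finset.sum_const, Finset.card_univ, nsmul_eq_mul]
    have hcard : (Fintype.card (Tor L) : ℂ) = (L : ℂ) ^ 2 := by
      rw [Fintype.card_prod, ZMod.card]; push_cast; ring
    rw [hcard, hmdef]
    field_simp
    push_cast
    ring
  have key := hG z₁ z₂ hz (fun x => f x - m) hzero
  simp only [sub_sub_sub_cancel_right] at key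
  rw [punctured_variance L f hz hf1 hf2] at key
  refine le_trans key (le_of_eq ?_)
  congr 1
  refine Finset.sum_congr rfl fun x _ => ?_
  rw [nnList_map_sum, hF, hF, hF, hF]

/-- **zero row:** if the line function vanishes identically the row inequality is trivial. [folklore] -/
theorem frozen_row_zero (g : ℝ) (f : Tor L → ℂ) (hf : ∀ x, f x = 0) (F : Tor L → Tor L → ℝ) (hF : ∀ x e, 0 ≤ F x e) :
    g * (∑ x : Tor L, ‖f x‖ ^ 2 - ‖∑ x : Tor L, f x‖ ^ 2 / ((L : ℝ) ^ 2 - 2))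
      ≤ (1 / 4) * ∑ x : Tor L, (F x (ex L) + F x (-ex L) + F x (ey L) + F x (-ey L)) := by
  have h0 : ∑ x : Tor L, ‖f x‖ ^ 2 = 0 := by simp [hf]
  have h1 : ∑ x : Tor L, f x = 0 := by simp [hf]
  rw [h0, h1, norm_zero]
  have : g * ((0 : ℝ) - 0 ^ 2 / ((L : ℝ) ^ 2 - 2)) = 0 := by ring
  rw [this]
  exact mul_nonneg (by norm_num) (Finset.sum_nonneg fun x _ => by
    linarith [hF x (ex L), hF x (-ex L), hF x (ey L), hF x (-ey L)])

/-! ## The three frozen families -/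

/-- family 2 summand: hop `(a,b) → (a+e,b)`. [folklore] -/
def fz2 (ψ : Cfg L → ℂ) (c : Cfg L) (e : Tor L) : ℝ :=
  if (InD L c = true ∨ InD L (c.1 + e, c.2) = true) then 0 else ‖ψ c - ψ (c.1 + e, c.2)‖ ^ 2

/-- family 3 summand: hop `(a,b) → (a,b+e)`. [folklore] -/
def fz3 (ψ : Cfg L → ℂ) (c : Cfg L) (e : Tor L) : ℝ :=
  if (InD L c = true ∨ InD L (c.1, c.2 + e) = true) then 0 else ‖ψ c - ψ (c.1, c.2 + e)‖ ^ 2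

/-- family 1 summand: twisted diagonal hop `(a,b) → (a−e,b−e)`. [folklore] -/
def fz1 (ψ : Cfg L → ℂ) (c : Cfg L) (e : Tor L) : ℝ :=
  if (InD L c = true ∨ InD L (c.1 - e, c.2 - e) = true) then 0 else ‖ψ c - phase L (K1 L) e * ψ (c.1 - e, c.2 - e)‖ ^ 2

omit [NeZero L] in
/-- [folklore] -/
theorem fz2_nonneg (ψ : Cfg L → ℂ) (c : Cfg L) (e : Tor L) : 0 ≤ fz2 L ψ c e := by
  unfold fz2; split_ifs; exact le_rfl; positivity

omit [NeZero L] in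
/-- [folklore] -/
theorem fz3_nonneg (ψ : Cfg L → ℂ) (c : Cfg L) (e : Tor L) : 0 ≤ fz3 L ψ c e := by
  unfold fz3; split_ifs; exact le_rfl; positivity

omit [NeZero L] in
/-- [folklore] -/
theorem fz1_nonneg (ψ : Cfg L → ℂ) (c : Cfg L) (e : Tor L) : 0 ≤ fz1 L ψ c e := by
  unfold fz1; split_ifs; exact le_rfl; positivity

omit [NeZero L] in
/-- two guarded squares with equivalent guards and equal values agree. [folklore] -/
theorem ite_zero_congr {P Q : Prop} [Decidable P] [Decidable Q] (h : P ↔ Q) (x : ℝ) :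
    (if P then (0 : ℝ) else x) = if Q then 0 else x := by
  by_cases hq : Q
  · rw [if_pos hq, if_pos (h.2 hq)]
  · rw [if_neg hq, if_neg (fun hp => hq (h.1 hp))]

/-- the three-particle sum along diagonals: `Σ_c G(c) = Σ_d Σ_b G(b+d, b)`. [folklore] -/
theorem sum_cfg_diag {α : Type*} [AddCommMonoid α] (G : Cfg L → α) :
    ∑ c : Cfg L, G c = ∑ d : Tor L, ∑ b : Tor L, G (b + d, b) := by
  rw [Fintype.sum_prod_type, Finset.sum_comm]
  have h : ∀ b : Tor L, ∑ a : Tor L, G (a, b) = ∑ d : Tor L, G (b + d, b) := fun b =>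
    (Fintype.sum_equiv (Equiv.addRight b) (fun d => G (b + d, b)) (fun a => G (a, b))
      (fun d => by simp only [Equiv.coe_addRight, add_comm])).symm
  simp_rw [h]
  rw [Finset.sum_comm]

/-- removing the `K₁`-twist along a diagonal by the unit gauge `conj φ_{K₁}(b)`. [folklore] -/
theorem norm_twist (K b e : Tor L) (u v : ℂ) :
    ‖(starRingEnd ℂ) (phase L K b) * u - (starRingEnd ℂ) (phase L K (b + e)) * v‖ = ‖u - phase L K (-e) * v‖ := by
  have h1 : (starRingEnd ℂ) (phase L K b) * u - (starRingEnd ℂ) (phase L K (b + e)) * v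
      = (starRingEnd ℂ) (phase L K b) * (u - phase L K (-e) * v) := by
    rw [conj_phase, conj_phase, neg_add, phase_add]; ring
  rw [h1, norm_mul, Complex.norm_conj, norm_phase, one_mul]

/-- **family 2** (particle 2 hops, particle 3 frozen at `b`, holes `a ∈ {0, b}`):
`g(‖ψ‖² − (V/(V−2))·restSq2) ≤ ¼ Σ_c Σ_e fz2`. [folklore] -/
theorem fam2_bound {g : ℝ} (hG : TwoHoleGap L g) (ψ : Cfg L → ℂ) (hψ : ∀ c : Cfg L, InD L c = true → ψ c = 0) :
    g * ((ip L ψ ψ).re - ((L : ℝ) ^ 2 / ((L : ℝ) ^ 2 - 2)) * restSq2 L ψ)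
      ≤ (1 / 4) * ∑ c : Cfg L, ((nnList L).map (fz2 L ψ c)).sum := by
  have hL0 : (L : ℝ) ≠ 0 := Nat.cast_ne_zero.mpr (NeZero.ne L)
  have e2 : ((L : ℝ) ^ 2 / ((L : ℝ) ^ 2 - 2)) * restSq2 L ψ
      = ∑ b : Tor L, ‖∑ a : Tor L, ψ (a, b)‖ ^ 2 / ((L : ℝ) ^ 2 - 2) := by
    unfold restSq2; rw [← Finset.sum_div]; field_simp
  have lhs : (ip L ψ ψ).re - ((L : ℝ) ^ 2 / ((L : ℝ) ^ 2 - 2)) * restSq2 L ψ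
      = ∑ b : Tor L, (∑ a : Tor L, ‖ψ (a, b)‖ ^ 2 - ‖∑ a : Tor L, ψ (a, b)‖ ^ 2 / ((L : ℝ) ^ 2 - 2)) := by
    rw [ip_self_re, Fintype.sum_prod_type, Finset.sum_comm, e2, ← Finset.sum_sub_distrib]
  have rhs : ∑ c : Cfg L, ((nnList L).map (fz2 L ψ c)).sum
      = ∑ b : Tor L, ∑ a : Tor L,
          (fz2 L ψ (a, b) (ex L) + fz2 L ψ (a, b) (-ex L) + fz2 L ψ (a, b) (ey L) + fz2 L ψ (a, b) (-ey L)) := by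
    simp_rw [nnList_map_sum]
    rw [Fintype.sum_prod_type, Finset.sum_comm]
  rw [lhs, rhs, Finset.mul_sum, Finset.mul_sum]
  refine Finset.sum_le_sum fun b _ => ?_
  by_cases hb : b = 0
  · subst hb
    exact frozen_row_zero L g (fun a => ψ (a, 0)) (fun a => hψ _ ((inD_iff L a 0).2 (Or.inr (Or.inl rfl))))
      (fun a e => fz2 L ψ (a, 0) e) (fun a e => fz2_nonneg L ψ _ _)
  · refine frozen_row_bound L hG (z₁ := 0) (z₂ := b) (Ne.symm hb) (fun a => ψ (a, b))
      (hψ _ ((inD_iff L 0 b).2 (Or.inl rfl))) (hψ _ ((inD_iff L b b).2 (Or.inr (Or.inr rfl))))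
      (fun a e => fz2 L ψ (a, b) e) (fun a e => ?_)
    show (if (InD L (a, b) = true ∨ InD L (a + e, b) = true) then (0 : ℝ) else ‖ψ (a, b) - ψ (a + e, b)‖ ^ 2) = _
    refine ite_zero_congr ?_ _
    rw [inD_iff, inD_iff]
    tauto

/-- **family 3** (particle 3 hops, particle 2 frozen at `a`, holes `b ∈ {0, a}`):
`g(‖ψ‖² − (V/(V−2))·restSq3) ≤ ¼ Σ_c Σ_e fz3`. [folklore] -/
theorem fam3_bound {g : ℝ} (hG : TwoHoleGap L g) (ψ : Cfg L → ℂ) (hψ : ∀ c : Cfg L, InD L c = true → ψ c = 0) :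
    g * ((ip L ψ ψ).re - ((L : ℝ) ^ 2 / ((L : ℝ) ^ 2 - 2)) * restSq3 L ψ)
      ≤ (1 / 4) * ∑ c : Cfg L, ((nnList L).map (fz3 L ψ c)).sum := by
  have hL0 : (L : ℝ) ≠ 0 := Nat.cast_ne_zero.mpr (NeZero.ne L)
  have e3 : ((L : ℝ) ^ 2 / ((L : ℝ) ^ 2 - 2)) * restSq3 L ψ
      = ∑ a : Tor L, ‖∑ b : Tor L, ψ (a, b)‖ ^ 2 / ((L : ℝ) ^ 2 - 2) := by
    unfold restSq3; rw [← Finset.sum_div]; field_simp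
  have lhs : (ip L ψ ψ).re - ((L : ℝ) ^ 2 / ((L : ℝ) ^ 2 - 2)) * restSq3 L ψ
      = ∑ a : Tor L, (∑ b : Tor L, ‖ψ (a, b)‖ ^ 2 - ‖∑ b : Tor L, ψ (a, b)‖ ^ 2 / ((L : ℝ) ^ 2 - 2)) := by
    rw [ip_self_re, Fintype.sum_prod_type, e3, ← Finset.sum_sub_distrib]
  have rhs : ∑ c : Cfg L, ((nnList L).map (fz3 L ψ c)).sum
      = ∑ a : Tor L, ∑ b : Tor L,
          (fz3 L ψ (a, b) (ex L) + fz3 L ψ (a, b) (-ex L) + fz3 L ψ (a, b) (ey L) + fz3 L ψ (a, b) (-ey L)) := by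
    simp_rw [nnList_map_sum]
    rw [Fintype.sum_prod_type]
  rw [lhs, rhs, Finset.mul_sum, Finset.mul_sum]
  refine Finset.sum_le_sum fun a _ => ?_
  by_cases ha : a = 0
  · subst ha
    exact frozen_row_zero L g (fun b => ψ (0, b)) (fun b => hψ _ ((inD_iff L 0 b).2 (Or.inl rfl)))
      (fun b e => fz3 L ψ (0, b) e) (fun b e => fz3_nonneg L ψ _ _)
  · refine frozen_row_bound L hG (z₁ := 0) (z₂ := a) (Ne.symm ha) (fun b => ψ (a, b))
      (hψ _ ((inD_iff L a 0).2 (Or.inr (Or.inl rfl)))) (hψ _ ((inD_iff L a a).2 (Or.inr (Or.inr rfl))))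
      (fun b e => fz3 L ψ (a, b) e) (fun b e => ?_)
    show (if (InD L (a, b) = true ∨ InD L (a, b + e) = true) then (0 : ℝ) else ‖ψ (a, b) - ψ (a, b + e)‖ ^ 2) = _
    refine ite_zero_congr ?_ _
    rw [inD_iff, inD_iff]
    constructor
    · rintro ((h | h | h) | (h | h | h))
      · exact (ha h).elim
      · exact Or.inl h
      · exact Or.inr (Or.inl h.symm)
      · exact (ha h).elim
      · exact Or.inr (Or.inr (Or.inl h))
      · exact Or.inr (Or.inr (Or.inr h.symm))
    · rintro (h | h | h | h)
      · exact Or.inl (Or.inr (Or.inl h))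
      · exact Or.inl (Or.inr (Or.inr h.symm))
      · exact Or.inr (Or.inr (Or.inl h))
      · exact Or.inr (Or.inr (Or.inr h.symm))

/-- **family 1** (particle 1 hops with the `K₁`-twist, particles 2,3 frozen at separation `d`, line `c = (b+d, b)`,
gauge `f_d(b) = conj φ_{K₁}(b)·ψ(b+d,b)`, holes `b ∈ {0, −d}`): `g(‖ψ‖² − (V/(V−2))·restSq1) ≤ ¼ Σ_c Σ_e fz1`. [folklore] -/
theorem fam1_bound {g : ℝ} (hG : TwoHoleGap L g) (ψ : Cfg L → ℂ) (hψ : ∀ c : Cfg L, InD L c = true → ψ c = 0) :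
    g * ((ip L ψ ψ).re - ((L : ℝ) ^ 2 / ((L : ℝ) ^ 2 - 2)) * restSq1 L ψ)
      ≤ (1 / 4) * ∑ c : Cfg L, ((nnList L).map (fz1 L ψ c)).sum := by
  have hL0 : (L : ℝ) ≠ 0 := Nat.cast_ne_zero.mpr (NeZero.ne L)
  -- the gauged line functions
  set fd : Tor L → Tor L → ℂ := fun d b => (starRingEnd ℂ) (phase L (K1 L) b) * ψ (b + d, b) with hfd
  have hnorm : ∀ d b : Tor L, ‖fd d b‖ ^ 2 = ‖ψ (b + d, b)‖ ^ 2 := by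
    intro d b; simp only [hfd, norm_mul, Complex.norm_conj, norm_phase, one_mul]
  have e1 : ((L : ℝ) ^ 2 / ((L : ℝ) ^ 2 - 2)) * restSq1 L ψ
      = ∑ d : Tor L, ‖∑ b : Tor L, fd d b‖ ^ 2 / ((L : ℝ) ^ 2 - 2) := by
    unfold restSq1; simp only [hfd]; rw [← Finset.sum_div]; field_simp
  have lhs : (ip L ψ ψ).re - ((L : ℝ) ^ 2 / ((L : ℝ) ^ 2 - 2)) * restSq1 L ψ
      = ∑ d : Tor L, (∑ b : Tor L, ‖fd d b‖ ^ 2 - ‖∑ b : Tor L, fd d b‖ ^ 2 / ((L : ℝ) ^ 2 - 2)) := by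
    rw [ip_self_re, sum_cfg_diag L (fun c => ‖ψ c‖ ^ 2), e1, ← Finset.sum_sub_distrib]
    simp_rw [hnorm]
  have rhs : ∑ c : Cfg L, ((nnList L).map (fz1 L ψ c)).sum
      = ∑ d : Tor L, ∑ b : Tor L,
          (fz1 L ψ (b + d, b) (-ex L) + fz1 L ψ (b + d, b) (- -ex L) + fz1 L ψ (b + d, b) (-ey L)
            + fz1 L ψ (b + d, b) (- -ey L)) := by
    simp_rw [nnList_map_sum, neg_neg]
    rw [sum_cfg_diag L (fun c => fz1 L ψ c (ex L) + fz1 L ψ c (-ex L) + fz1 L ψ c (ey L) + fz1 L ψ c (-ey L))]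
    refine Finset.sum_congr rfl fun d _ => Finset.sum_congr rfl fun b _ => ?_
    ring
  rw [lhs, rhs, Finset.mul_sum, Finset.mul_sum]
  refine Finset.sum_le_sum fun d _ => ?_
  by_cases hd : d = 0
  · subst hd
    refine frozen_row_zero L g (fd 0) (fun b => ?_) (fun b e => fz1 L ψ (b + 0, b) (-e)) (fun b e => fz1_nonneg L ψ _ _)
    simp only [hfd, add_zero, hψ _ ((inD_iff L b b).2 (Or.inr (Or.inr rfl))), mul_zero]
  · have hz : (0 : Tor L) ≠ -d := fun h => hd (by rw [← neg_eq_zero]; exact h.symm)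
    refine frozen_row_bound L hG (z₁ := 0) (z₂ := -d) hz (fd d) ?_ ?_
      (fun b e => fz1 L ψ (b + d, b) (-e)) (fun b e => ?_)
    · simp only [hfd, zero_add, hψ _ ((inD_iff L d 0).2 (Or.inr (Or.inl rfl))), mul_zero]
    · simp only [hfd, neg_add_cancel, hψ _ ((inD_iff L 0 (-d)).2 (Or.inl rfl)), mul_zero]
    · show (if (InD L (b + d, b) = true ∨ InD L (b + d - -e, b - -e) = true) then (0 : ℝ)
          else ‖ψ (b + d, b) - phase L (K1 L) (-e) * ψ (b + d - -e, b - -e)‖ ^ 2) = _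
      simp only [sub_neg_eq_add, hfd]
      rw [show b + e + d = b + d + e from add_right_comm b e d, norm_twist]
      refine ite_zero_congr ?_ _
      rw [inD_iff, inD_iff]
      have i1 : b + d = 0 ↔ b = -d := eq_neg_iff_add_eq_zero.symm
      have i2 : ¬ (b + d = b) := fun h => hd (by simpa using h)
      have i3 : b + d + e = 0 ↔ b + e = -d := by rw [add_right_comm]; exact eq_neg_iff_add_eq_zero.symm
      have i4 : ¬ (b + d + e = b + e) := fun h => hd (by rw [add_right_comm] at h; simpa using h)
      tauto

/-! ## LEMMA V′ -/

/-- **`LemmaVPrimeSharp` holds (`L ≥ 3`):** for `ψ` vanishing on the hard core and `gap₂ ≥ g ≥ 0`,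
`g·(3‖ψ‖² − (V/(V−2))·Σ_i ‖Π_i⁰ψ‖²) ≤ Re⟨ψ,(H₀^{K₁} − W)ψ⟩`. [folklore] -/
theorem lemmaVPrimeSharp_holds (hL : 3 ≤ L) : LemmaVPrimeSharp L := by
  intro g _hg hG ψ hψ
  rw [freezeIdentity_holds L hL ψ hψ]
  show _ ≤ (1 / 4 : ℝ) * ∑ c : Cfg L, ((nnList L).map (fun e => fz2 L ψ c e + fz3 L ψ c e + fz1 L ψ c e)).sum
  have split : ∀ c : Cfg L, ((nnList L).map (fun e => fz2 L ψ c e + fz3 L ψ c e + fz1 L ψ c e)).sum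
      = ((nnList L).map (fz2 L ψ c)).sum + ((nnList L).map (fz3 L ψ c)).sum + ((nnList L).map (fz1 L ψ c)).sum := by
    intro c; rw [nnList_map_sum, nnList_map_sum, nnList_map_sum, nnList_map_sum]; ring
  simp_rw [split]
  rw [Finset.sum_add_distrib, Finset.sum_add_distrib]
  have h2 := fam2_bound L hG ψ hψ
  have h3 := fam3_bound L hG ψ hψ
  have h1 := fam1_bound L hG ψ hψ
  have e : g * (3 * (ip L ψ ψ).re - ((L : ℝ) ^ 2 / ((L : ℝ) ^ 2 - 2)) * (restSq1 L ψ + restSq2 L ψ + restSq3 L ψ))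
      = g * ((ip L ψ ψ).re - ((L : ℝ) ^ 2 / ((L : ℝ) ^ 2 - 2)) * restSq2 L ψ)
        + g * ((ip L ψ ψ).re - ((L : ℝ) ^ 2 / ((L : ℝ) ^ 2 - 2)) * restSq3 L ψ)
        + g * ((ip L ψ ψ).re - ((L : ℝ) ^ 2 / ((L : ℝ) ^ 2 - 2)) * restSq1 L ψ) := by ring
  rw [e, mul_add, mul_add]
  linarith

/-- **LEMMA V′ holds (`L ≥ 3`, all permutation sectors):** `gap₂ ≥ g ≥ 0 ⇒ SecondGapK1 L (g(2 − 2/(V−2)) − ε₁)`. [folklore] -/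
theorem lemmaVPrime_holds (hL : 3 ≤ L) : LemmaVPrime L := by
  intro g hg hG ψ hD hP
  have h1 := lemmaVPrimeSharp_holds L hL g hg hG ψ hD
  have h2 := poleCount_holds L ψ hP
  have hL' : (3 : ℝ) ≤ (L : ℝ) := by exact_mod_cast hL
  have hV2 : 0 < (L : ℝ) ^ 2 - 2 := by nlinarith
  have hq : 0 ≤ (L : ℝ) ^ 2 / ((L : ℝ) ^ 2 - 2) := by positivity
  have hN : 0 ≤ (ip L ψ ψ).re := by rw [ip_self_re]; positivity
  have h3 : g * ((L : ℝ) ^ 2 / ((L : ℝ) ^ 2 - 2)) * (restSq1 L ψ + restSq2 L ψ + restSq3 L ψ)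
      ≤ g * ((L : ℝ) ^ 2 / ((L : ℝ) ^ 2 - 2)) * (ip L ψ ψ).re :=
    mul_le_mul_of_nonneg_left h2 (mul_nonneg hg hq)
  have e : (eps1 L + (g * (2 - 2 / ((L : ℝ) ^ 2 - 2)) - eps1 L)) * (ip L ψ ψ).re
      = g * (3 * (ip L ψ ψ).re) - g * ((L : ℝ) ^ 2 / ((L : ℝ) ^ 2 - 2)) * (ip L ψ ψ).re := by
    field_simp
    ring
  rw [e]
  linarith

/-- **`SecondGapK1OfHole75` holds (every `L`):** `4 ≤ L ⇒ TwoHoleGap L (¾ε₁) ⇒ SecondGapK1 L (ε₁cos²θ/2)` — the spectral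
input of the GM₃ certificate from ONE one-body random-walk fact, HOLE₂(.75). [folklore] -/
theorem secondGapK1OfHole75_holds : SecondGapK1OfHole75 L := by
  intro hL4 hH
  exact secondGapK1OfHole75_of_lemmaVPrime L (lemmaVPrime_holds L (by omega)) hL4 hH

/-! ## The GM₃ assembly with the one-body spectral input -/

/-- **GM₃ from the three β-free cruxes and HOLE₂(.75):** `gm3_of_cruxes_secondGap` with its spectral hypothesis
`SecondGapK1 L (ε₁cos²θ/2)` discharged by LEMMA V′ from `TwoHoleGap L (¾ε₁)`. [folklore] -/
theorem gm3_of_cruxes_twoHoleGap (hL4 : 4 ≤ L) {Δ : ℝ} (hΔ0 : 0 < Δ) (hΔ1 : Δ < 1) (c a b : ℝ) {ρ : ℝ} (hρ : 0 < ρ)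
    (hH2 : TwoHoleGap L (3 / 4 * eps1 L))
    {lam2 : ℝ} {f : Tor L → ℝ} (hf : IsGroundTwoMagnon L Δ lam2 f) (hT2 : Tplus L Δ f < 2 * eps1 L)
    (hm : 0 ≤ mHole L Δ f) (hside : facMI L Δ f * etaEff L lam2 * (a + b / ρ) < c)
    (hKT1 : TrialGapAbs L Δ c) (hKT2a : LowShellGFormAbs L Δ a) (hKT2b : OffPoleTailAbs L Δ b)
    (hden : DenMinRest L Δ ρ) : GM3Fibre L Δ :=
  gm3_of_cruxes_secondGap L hL4 hΔ0 hΔ1 c a b hρ (secondGapK1OfHole75_holds L hL4 hH2) hf hT2 hm hside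
    hKT1 hKT2a hKT2b hden

/-- **GM₃ from the three β-free cruxes and HOLE₂(.75), `ρ = 2 + cos θ` discharged** (`8 ≤ L`). [folklore] -/
theorem gm3_closedRho_twoHoleGap (hL : 8 ≤ L) {Δ : ℝ} (hΔ0 : 0 < Δ) (hΔ1 : Δ < 1) (c a b : ℝ)
    (hH2 : TwoHoleGap L (3 / 4 * eps1 L))
    {lam2 : ℝ} {f : Tor L → ℝ} (hf : IsGroundTwoMagnon L Δ lam2 f) (hT2 : Tplus L Δ f < 2 * eps1 L)
    (hm : 0 ≤ mHole L Δ f)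
    (hside : facMI L Δ f * etaEff L lam2 * (a + b / (2 + Real.cos (2 * Real.pi / L))) < c)
    (hKT1 : TrialGapAbs L Δ c) (hKT2a : LowShellGFormAbs L Δ a) (hKT2b : OffPoleTailAbs L Δ b) : GM3Fibre L Δ :=
  gm3_closedRho_secondGap L hL hΔ0 hΔ1 c a b (secondGapK1OfHole75_holds L (by omega) hH2) hf hT2 hm hside
    hKT1 hKT2a hKT2b

end Summit.HubbardSuperconductivity.HubbardSuperconductivity.Theorems.AnisotropyChord.Transfer.Fibre3

end
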